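import Summits.KontsevichZagierPeriods.KontsevichZagierPeriods.Theorems.UnfoldedStokesStokesGenerationFibrewiseRungDimOneRational
import Summits.KontsevichZagierPeriods.KontsevichZagierPeriods.Theorems.UnfoldedStokesStokesGenerationFibrewiseClosurePad
import Summits.KontsevichZagierPeriods.KontsevichZagierPeriods.Theorems.UnfoldedStokesStokesGenerationFibrewiseClosure
import Summits.KontsevichZagierPeriods.KontsevichZagierPeriods.Theorems.UnfoldedStokesStokesGenerationStubAngTransport
import Summits.KontsevichZagierPeriods.KontsevichZagierPeriods.Theorems.UnfoldedStokesStokesGenerationStubParamHalfAngleCertificate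
import Summits.KontsevichZagierPeriods.KontsevichZagierPeriods.Theorems.UnfoldedStokesStokesGenerationStubLoopLinearFactors

/-!
# `StokesGeneration` (stmt-KontsevichZagierPeriods-3586), line `fibrewise_stokes` — rung 9a/b: the angular transposition sector

Crux `Summit.KontsevichZagierPeriods.KontsevichZagierPeriods.Theses.UnfoldedStokes.StokesGeneration`; residual S2 =
`FibrewiseStokesGenerationConjecture` (every bounded value-0 closed-cube integrand is `FibStokesDecomposable` — in particular WITHOUT
the change-of-variables move). Rung 9 (lead c5) shows that S2's economy absorbs the COORDINATE TRANSPOSITION of every angular atom: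
for a zero-free complex polynomial loop `P = A + iB` on `[0,1]` with real algebraic coefficients and `γ` real algebraic,
`γ(ω_P(x₀) − ω_P(x₁))`, `ω_P = Im(P′/P) = (A B′ − A′ B)/(A² + B²)`, is fibrewise-Stokes decomposable on the square
(`fibStokesDecomposable_angSwap`) — the angular twin of rung 6's dlog transposition, equally BAKER-FREE:
* loops in the right half-plane (`fibStokesDecomposable_angSwapPos`): eleven elements on `[0,1]⁴` — the three-element closed-form
  transport of `arg((1 − y)P(x₁) + yP(x₀))` (`stub_angTransport`, p132367; `b = Im(P(x₀) conj P(x₁))/|W|²`) leaves four segment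
  loops in the homotopy variable `y` with a silent parameter, each certified by two elements with the half-angle kernels
  `K = T/(1 + T²w²)`, `M = w ∂_yT/(1 + w²T²)` (`stub_paramHalfAngleCertificate`, p131768), whose eight face terms
  `κ(T(1)) − κ(T(0))` telescope to zero;
* general zero-free loops factor over `ℚ̄` into linear loops rotated into the right half-plane with the same total angular
  derivative (`stub_loopLinearFactors`, p131849), and finite sums of decomposable functions are decomposable.
Bookkeeping: a finite family of elements is decomposable (`fibStokesDecomposable_of_elements`); un-padding (`fibStokesDecomposable_unpad`).

References: M. Kontsevich, D. Zagier, *Periods* (2001), §1.2 rule (2) and Conjecture 1; J. Ayoub, Ann. of Math. 181 (2015),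
Conj. 1.1, Rem. 1.5; J. Fresán, *Une introduction aux périodes* (2024), Rem. 3.7; A. Baker, *Transcendental Number Theory* (1975), Thm. 2.1.
-/

noncomputable section

set_option linter.dupNamespace false

namespace Summit.KontsevichZagierPeriods.KontsevichZagierPeriods.Cruxes.StokesGeneration.FibrewiseStokes

open MeasureTheory Set
open Literature.NumberTheory.Transcendental
open Literature.NumberTheory.Transcendental.KZ
open Literature.ModelTheory.ExponentialFields (IsSemialgebraic)

/-! ## Generic bookkeeping: a family of elements; un-padding -/

/-- **A finite family of fibrewise Stokes elements (without kink sets) on one cube has a decomposable sum.** [folklore] -/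
theorem fibStokesDecomposable_of_elements {M J : ℕ} (dir : Fin J → Fin M) (G D : Fin J → (Fin M → ℝ) → ℝ)
    (r : Fin J → IntegralRep M)
    (hpack : ∀ j, IsSemialgebraicFunOn ℚ (Set.pi Set.univ (fun _ : Fin M => Set.Icc (0:ℝ) 1)) (G j) ∧
      IsSemialgebraicFunOn ℚ (Set.pi Set.univ (fun _ : Fin M => Set.Icc (0:ℝ) 1)) (D j) ∧
      (∃ Bd : ℝ, ∀ x ∈ Set.pi Set.univ (fun _ : Fin M => Set.Icc (0:ℝ) 1), |(G j) x| ≤ Bd) ∧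
      (∀ x ∈ Set.pi Set.univ (fun _ : Fin M => Set.Icc (0:ℝ) 1),
        ContinuousOn (fun s : ℝ => (G j) (Function.update x (dir j) s)) (Set.Icc (0:ℝ) 1)) ∧
      (∀ x ∈ Set.pi Set.univ (fun _ : Fin M => Set.Icc (0:ℝ) 1), x (dir j) ∈ Set.Ioo (0:ℝ) 1 →
        HasDerivAt (fun s : ℝ => (G j) (Function.update x (dir j) s)) ((D j) x) (x (dir j))))
    (hr : ∀ j, (r j).domain = Set.pi Set.univ (fun _ : Fin M => Set.Icc (0:ℝ) 1) ∧
      ∀ x ∈ Set.pi Set.univ (fun _ : Fin M => Set.Icc (0:ℝ) 1), (r j).integrand x =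
        D j x - (G j (Function.update x (dir j) 1) - G j (Function.update x (dir j) 0))) :
    FibStokesDecomposable M (fun x => ∑ j, (r j).integrand x) := by
  refine ⟨M, le_rfl, J, dir, G, D, fun _ => ∅, r, ∅, fun j => ?_, hr,
    Literature.ModelTheory.ExponentialFields.isSemialgebraic_empty, measure_empty, fun x _ _ => ?_⟩
  · obtain ⟨h1, h2, h3, h4, h5⟩ := hpack j
    exact ⟨h1, h2, Literature.ModelTheory.ExponentialFields.isSemialgebraic_empty, h3, fun x _ => by simp, h4,
      fun x hx _ hxi => h5 x hx hxi⟩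
  · rfl

/-- **Un-padding.** If `h` read on the first `M` coordinates of `[0,1]^N` is decomposable, so is `h` on `[0,1]^M` (the
padding of a padding is a padding). [folklore] -/
theorem fibStokesDecomposable_unpad {M N : ℕ} (hMN : M ≤ N) (h : (Fin M → ℝ) → ℝ)
    (hh : FibStokesDecomposable N (fun x => h (fun l => x (Fin.castLE hMN l)))) : FibStokesDecomposable M h := by
  obtain ⟨M', hNM', J, i, G, D, K, q, Z, hpack, hq, hZs, hZ0, hid⟩ := hh
  exact ⟨M', hMN.trans hNM', J, i, G, D, K, q, Z, hpack, hq, hZs, hZ0, fun x hx hxZ => hid x hx hxZ⟩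

/-! ## Rung 9a: the angular self-transposition for a loop in the right half-plane -/

/-- **S2 absorbs the coordinate transposition of an angular atom (loop in the right half-plane; rung 9a; lead c5).**
For a polynomial loop `P = A + iB` with real algebraic coefficients and `A > 0` on `[0,1]` and `γ` real algebraic,
the transposition `γ(ω_P(x₀) − ω_P(x₁))`, `ω_P = (A B′ − A′ B)/(A² + B²)`, is fibrewise-Stokes decomposable on the square —
eleven elements on `[0,1]⁴`, Baker-free: the three-element transport of `arg((1 − y)P(x₁) + yP(x₀))`
(`stub_angTransport` with `Q = P`) and the two-element half-angle certificates of the four leftover segment loops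
(`stub_paramHalfAngleCertificate`), whose eight face terms telescope to zero. [cite: KontsevichZagier2001, §1.2 rule (2)] -/
theorem fibStokesDecomposable_angSwapPos (γ : ℝ) (A B : Polynomial ℝ) (hγ : IsAlgebraic ℚ γ)
    (hA : ∀ n, IsAlgebraic ℚ (A.coeff n)) (hB : ∀ n, IsAlgebraic ℚ (B.coeff n))
    (hApos : ∀ u ∈ Set.Icc (0:ℝ) 1, 0 < A.eval u) :
    FibStokesDecomposable 2 (fun z => γ * ((A.eval (z 0) * (Polynomial.derivative B).eval (z 0) -
        (Polynomial.derivative A).eval (z 0) * B.eval (z 0)) / (A.eval (z 0) ^ 2 + B.eval (z 0) ^ 2) -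
      (A.eval (z 1) * (Polynomial.derivative B).eval (z 1) -
        (Polynomial.derivative A).eval (z 1) * B.eval (z 1)) / (A.eval (z 1) ^ 2 + B.eval (z 1) ^ 2))) := by
  classical
  have hS1 := isSemialgebraic_cubePi_one
  have h0 : (0:ℝ) ∈ Set.Icc (0:ℝ) 1 := ⟨le_rfl, zero_le_one⟩
  have h1 : (1:ℝ) ∈ Set.Icc (0:ℝ) 1 := ⟨zero_le_one, le_rfl⟩
  -- semialgebraicity / continuity of the endpoint data
  have hAsa : IsSemialgebraicFunOn ℚ (Set.pi Set.univ (fun _ : Fin 1 => Set.Icc (0:ℝ) 1)) (fun z => A.eval (z 0)) :=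
    isSemialgebraicFunOn_eval_apply hS1 hA 0
  have hBsa : IsSemialgebraicFunOn ℚ (Set.pi Set.univ (fun _ : Fin 1 => Set.Icc (0:ℝ) 1)) (fun z => B.eval (z 0)) :=
    isSemialgebraicFunOn_eval_apply hS1 hB 0
  have hcsa : ∀ (c : ℚ) (p : Polynomial ℝ), (∀ n, IsAlgebraic ℚ (p.coeff n)) →
      IsSemialgebraicFunOn ℚ (Set.pi Set.univ (fun _ : Fin 1 => Set.Icc (0:ℝ) 1)) (fun _ => p.eval (c : ℝ)) :=
    fun c p hp => isSemialgebraicFunOn_const_of_isAlgebraic hS1 (isAlgebraic_eval_ratCast p hp c)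
  have hA1sa := hcsa 1 A hA; have hA0sa := hcsa 0 A hA; have hB1sa := hcsa 1 B hB; have hB0sa := hcsa 0 B hB
  simp only [Rat.cast_one, Rat.cast_zero] at hA1sa hA0sa hB1sa hB0sa
  have hAc : ContinuousOn (fun u => A.eval u) (Set.Icc (0:ℝ) 1) := A.continuous.continuousOn
  have hBc : ContinuousOn (fun u => B.eval u) (Set.Icc (0:ℝ) 1) := B.continuous.continuousOn
  have h20 : (2 : Fin 4) ≠ 0 := by decide
  have h30 : (3 : Fin 4) ≠ 0 := by decide
  have h21 : (1 : Fin 4) ≠ 2 := by decide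
  have h31 : (1 : Fin 4) ≠ 3 := by decide
  -- the transport (three elements) and the four segment-loop certificates (two elements each)
  obtain ⟨G₀, D₀, r₀, hp₀, hr₀, hid₀⟩ := stub_angTransport γ A B A B hγ hA hB hA hB hApos hApos
  obtain ⟨G₁, D₁, r₁, hp₁, hr₁, hid₁⟩ := stub_paramHalfAngleCertificate γ 1 (fun u => A.eval u) (fun u => B.eval u)
    (fun _ => A.eval 1) (fun _ => B.eval 1) hγ h21 h31 hAsa hBsa hA1sa hB1sa hAc hBc continuousOn_const continuousOn_const
    hApos (fun _ _ => hApos 1 h1)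
  obtain ⟨G₂, D₂, r₂, hp₂, hr₂, hid₂⟩ := stub_paramHalfAngleCertificate γ 1 (fun u => A.eval u) (fun u => B.eval u)
    (fun _ => A.eval 0) (fun _ => B.eval 0) hγ h21 h31 hAsa hBsa hA0sa hB0sa hAc hBc continuousOn_const continuousOn_const
    hApos (fun _ _ => hApos 0 h0)
  obtain ⟨G₃, D₃, r₃, hp₃, hr₃, hid₃⟩ := stub_paramHalfAngleCertificate γ 0 (fun _ => A.eval 1) (fun _ => B.eval 1)
    (fun u => A.eval u) (fun u => B.eval u) hγ h20.symm h30.symm hA1sa hB1sa hAsa hBsa continuousOn_const continuousOn_const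
    hAc hBc (fun _ _ => hApos 1 h1) hApos
  obtain ⟨G₄, D₄, r₄, hp₄, hr₄, hid₄⟩ := stub_paramHalfAngleCertificate γ 0 (fun _ => A.eval 0) (fun _ => B.eval 0)
    (fun u => A.eval u) (fun u => B.eval u) hγ h20.symm h30.symm hA0sa hB0sa hAsa hBsa continuousOn_const continuousOn_const
    hAc hBc (fun _ _ => hApos 0 h0) hApos
  have hd₀ := fibStokesDecomposable_of_elements _ G₀ D₀ r₀ hp₀ hr₀
  have hd₁ := fibStokesDecomposable_of_elements _ G₁ D₁ r₁ hp₁ hr₁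
  have hd₂ := fibStokesDecomposable_of_elements _ G₂ D₂ r₂ hp₂ hr₂
  have hd₃ := fibStokesDecomposable_of_elements _ G₃ D₃ r₃ hp₃ hr₃
  have hd₄ := fibStokesDecomposable_of_elements _ G₄ D₄ r₄ hp₄ hr₄
  -- combine: `F₀ + F₁ − F₂ + F₃ − F₄`
  have hsum := fibStokesDecomposable_sub 4 _ _
    (fibStokesDecomposable_add 4 _ _ (fibStokesDecomposable_sub 4 _ _ (fibStokesDecomposable_add 4 _ _ hd₀ hd₁) hd₂) hd₃) hd₄
  -- un-pad to the square
  have h24 : (2:ℕ) ≤ 4 := by norm_num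
  refine fibStokesDecomposable_unpad h24 _ (fibStokesDecomposable_congr_off_null 4 _ _ ∅
    Literature.ModelTheory.ExponentialFields.isSemialgebraic_empty measure_empty (fun x hx _ => ?_) hsum)
  have hc0 : x (Fin.castLE h24 0) = x 0 := rfl
  have hc1 : x (Fin.castLE h24 1) = x 1 := rfl
  simp only [hc0, hc1]
  rw [hid₀ x hx, hid₁ x hx, hid₂ x hx, hid₃ x hx, hid₄ x hx]
  ring

/-! ## Rung 9b: the angular self-transposition for every zero-free polynomial loop -/

section General

open scoped Polynomial
open Summit.KontsevichZagierPeriods.HurwitzMicroSectors.NormalFormPrinciple.PiBox.AlgSplitK5 (isAlgebraic_coeK)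

/-- The linear polynomial `a X + b` with real algebraic `a, b`, as the image of a `K`-polynomial. [folklore] -/
theorem exists_linear_mapK {a b : ℝ} (ha : IsAlgebraic ℚ a) (hb : IsAlgebraic ℚ b) :
    ∃ L : Polynomial ℝ, (∀ n, IsAlgebraic ℚ (L.coeff n)) ∧ (∀ u, L.eval u = a * u + b) ∧
      ∀ u, (Polynomial.derivative L).eval u = a := by
  set aK : algebraicClosure ℚ ℝ := ⟨a, mem_algebraicClosure_iff.mpr ha⟩ with haK
  set bK : algebraicClosure ℚ ℝ := ⟨b, mem_algebraicClosure_iff.mpr hb⟩ with hbK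
  refine ⟨(Polynomial.C aK * Polynomial.X + Polynomial.C bK).map (algebraMap (algebraicClosure ℚ ℝ) ℝ),
    fun n => isAlgebraic_coeff_mapK _ n, fun u => ?_, fun u => ?_⟩
  · rw [eval_mapK, map_add, map_mul, Polynomial.aeval_C, Polynomial.aeval_X, Polynomial.aeval_C]; rfl
  · rw [eval_derivative_mapK, Polynomial.derivative_add, Polynomial.derivative_mul, Polynomial.derivative_C,
      Polynomial.derivative_X, Polynomial.derivative_C, zero_mul, zero_add, mul_one, add_zero, Polynomial.aeval_C]
    rfl

/-- **S2 absorbs the coordinate transposition of every angular atom (rung 9b; lead c5).** For a zero-free polynomial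
loop `P = A + iB` on `[0,1]` with real algebraic coefficients and `γ` real algebraic, `γ(ω_P(x₀) − ω_P(x₁))` is
fibrewise-Stokes decomposable on the square: `ω_P = Σᵢ ω_{Lᵢ}` for linear loops in the right half-plane
(`stub_loopLinearFactors`), each transposed by rung 9a; Baker-free. [cite: KontsevichZagier2001, §1.2 rule (2)] -/
theorem fibStokesDecomposable_angSwap (γ : ℝ) (A B : Polynomial ℝ) (hγ : IsAlgebraic ℚ γ)
    (hA : ∀ n, IsAlgebraic ℚ (A.coeff n)) (hB : ∀ n, IsAlgebraic ℚ (B.coeff n))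
    (hAB : ∀ u ∈ Set.Icc (0:ℝ) 1, A.eval u ^ 2 + B.eval u ^ 2 ≠ 0) :
    FibStokesDecomposable 2 (fun z => γ * ((A.eval (z 0) * (Polynomial.derivative B).eval (z 0) -
        (Polynomial.derivative A).eval (z 0) * B.eval (z 0)) / (A.eval (z 0) ^ 2 + B.eval (z 0) ^ 2) -
      (A.eval (z 1) * (Polynomial.derivative B).eval (z 1) -
        (Polynomial.derivative A).eval (z 1) * B.eval (z 1)) / (A.eval (z 1) ^ 2 + B.eval (z 1) ^ 2))) := by
  classical
  obtain ⟨s, a, b, c, d, ha, hb, hc, hd, hpos, hid⟩ := stub_loopLinearFactors A B hA hB hAB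
  have hL := fun i => exists_linear_mapK (ha i) (hb i)
  have hL' := fun i => exists_linear_mapK (hc i) (hd i)
  choose LA hLAa hLAe hLAd using hL
  choose LB hLBa hLBe hLBd using hL'
  have hLApos : ∀ i, ∀ u ∈ Set.Icc (0:ℝ) 1, 0 < (LA i).eval u := fun i u hu => by rw [hLAe]; exact hpos i u hu
  have hdec : ∀ i, FibStokesDecomposable 2 (fun z => γ * (((LA i).eval (z 0) * (Polynomial.derivative (LB i)).eval (z 0) -
        (Polynomial.derivative (LA i)).eval (z 0) * (LB i).eval (z 0)) / ((LA i).eval (z 0) ^ 2 + (LB i).eval (z 0) ^ 2) -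
      ((LA i).eval (z 1) * (Polynomial.derivative (LB i)).eval (z 1) -
        (Polynomial.derivative (LA i)).eval (z 1) * (LB i).eval (z 1)) / ((LA i).eval (z 1) ^ 2 + (LB i).eval (z 1) ^ 2))) :=
    fun i => fibStokesDecomposable_angSwapPos γ (LA i) (LB i) hγ (hLAa i) (hLBa i) (hLApos i)
  have hsum := fibStokesDecomposable_finsetSum Finset.univ _ fun i _ => hdec i
  refine fibStokesDecomposable_congr_off_null 2 _ _ ∅ Literature.ModelTheory.ExponentialFields.isSemialgebraic_empty
    measure_empty (fun z hz _ => ?_) hsum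
  have hz0 : z 0 ∈ Set.Icc (0:ℝ) 1 := hz 0 (Set.mem_univ _)
  have hz1 : z 1 ∈ Set.Icc (0:ℝ) 1 := hz 1 (Set.mem_univ _)
  simp only [hLAe, hLBe, hLAd, hLBd]
  rw [hid (z 0) hz0, hid (z 1) hz1, ← Finset.sum_sub_distrib, Finset.mul_sum]
  refine Finset.sum_congr rfl fun i _ => ?_
  ring

end General

end Summit.KontsevichZagierPeriods.KontsevichZagierPeriods.Cruxes.StokesGeneration.FibrewiseStokes

end
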